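import Summits.Schanuel.Schanuel.Theorems.SoloInformedX193Numerics
import Summits.Schanuel.Schanuel.Theorems.SoloInformedX193Inequalities

/-!
# X193 kernel line, file F7e: the count (no cheap assignment)

Solo seat `solo-Schanuel-informed`, X193 kernel programme (design note
`work/s213/X193-KERNEL-DESIGN.md`, Amendments A4–A8). The count of pen §7 assembled: abstract
service data satisfying the well-formedness, budget and entry laws admit NO cheap assignment
(H6) in the regime `β > 2`, `0 < σ ≤ 1`, `γ < σ`, `σ² < γ (β + σ)`, `ν = 1 + β - σ + γ`,
fares `0 < 2η < λ ≤ 1`.  Proof: on the window of levels `[N₀, ⌊N₀^{1+a}⌋₊]` (`a` the rate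
of `soloX_exists_rate`) with entry bound `E₀ = ⌊(λ/(8(1+b₁)))^{1/β} N₀^{(ν-1)/β}⌋₊` and
`K' = ⌊E₀^σ⌋₊` columns, the demand `(K' - A₆ N₁^δ) a log N₀ ≤ Σ |G n|/n`
(`soloX_demand_lower_rate`, `cheapAssignable_choose`) meets the supply
`Σ |G n|/n = O(N₀^{(1+a)δ} log² N₀)` (`supply_le`, `soloX_supply_upper`), while
`K' - A₆ N₁^δ ≫ N₀^{σ(ν-1)/β}` (`soloX_demand_coeff`) and `(1+a)δ < σ(ν-1)/β`
(`soloX_exists_rate`): contradiction for `N₀` large (`soloX_endgame`). No sorries.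
-/

namespace Summit.Schanuel.Schanuel.Theorems

open Filter

namespace SoloServiceData

variable {ι : Type*} (D : SoloServiceData ι)

section Count

variable [DecidableEq ι]

set_option maxHeartbeats 800000 in
/-- **The count of pen §7 (X193 kernel, layer A4–A8).** Service data satisfying the
well-formedness law, the budget law (Bud) and the entry law (L1) from level `n₀` on admit no
cheap assignment (H6) with fares `0 < 2η < λ ≤ 1` from any level `n₆` on, in the regime
`β > 2`, `0 < σ ≤ 1`, `γ < σ`, `σ² < γ (β + σ)` (i.e. `ν > 1 + β - σβ/(β+σ)`,
`soloX_threshold_iff`) and `ν + (σ - γ) = 1 + β`. -/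
theorem noCheapAssignment {c₀ β b₁ σ ν A₂ γ lam η B A₆ : ℝ} {n₀ n₆ : ℕ}
    (hW : D ∈ wellFormed c₀) (hB : D ∈ budgetLaw β b₁ n₀) (hE : D ∈ entryLaw β σ ν A₂ n₀)
    (hβ : 2 < β) (hσ : 0 < σ) (hσ1 : σ ≤ 1) (hγσ : γ < σ) (hthr : σ ^ 2 < γ * (β + σ))
    (hν : ν + (σ - γ) = 1 + β) (hlam1 : lam ≤ 1) (hη : 0 < η) (h2η : 2 * η < lam)
    (hb₁ : 0 ≤ b₁) (hBnn : 0 ≤ B) (hA₂ : 0 ≤ A₂) (hA₆ : 0 ≤ A₆) :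
    D ∉ cheapAssignable lam η σ γ ν β B A₆ n₆ := by
  intro h6
  -- exponents
  have hβ0 : 0 < β := by linarith
  have hβ1 : (1 : ℝ) ≤ β := by linarith
  have hγ : 0 < γ := by nlinarith [sq_nonneg σ]
  have hδ : 0 < σ - γ := sub_pos.mpr hγσ
  have hν2 : 2 < ν := by linarith
  have hν1 : 1 < ν := by linarith
  have hlam : 0 < lam := by linarith
  have he₀ : 0 < (ν - 1) / β := div_pos (by linarith) hβ0
  have he₀1 : (ν - 1) / β < 1 := by rw [div_lt_one hβ0]; linarith
  obtain ⟨a, ha, hrate⟩ := soloX_exists_rate hβ0 hγσ hthr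
  have hq : (1 + a) * (σ - γ) < (ν - 1) / β * σ := by
    have e : (ν - 1) / β * σ = σ * (1 - (σ - γ) / β) := by
      rw [show ν - 1 = β - (σ - γ) by linarith]
      field_simp
    rw [e]; exact hrate
  -- constants
  have hcE : 0 < lam / (8 * (1 + b₁)) := by positivity
  have hcE1 : lam / (8 * (1 + b₁)) ≤ 1 := by rw [div_le_one (by positivity)]; linarith
  have hc₁ : 0 < (lam / (8 * (1 + b₁))) ^ (1 / β) := Real.rpow_pos_of_pos hcE _
  have hc₁1 : (lam / (8 * (1 + b₁))) ^ (1 / β) ≤ 1 := Real.rpow_le_one hcE.le hcE1 (by positivity)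
  set r : ℝ := (2 * η) ^ (1 / (ν - 1)) with hrdef
  have hr : 0 < r := Real.rpow_pos_of_pos (by linarith) _
  have hr1 : r < 1 := soloX_ratio_lt_one hη.le (by linarith) hν1
  have hrν : r ^ (ν - 1) = 2 * η := soloX_ratio_rpow hη.le hν1
  set κ : ℝ := (1 + r) / (2 * r) with hκdef
  have hκ : 1 < κ := soloX_kappa_gt_one hr hr1
  set θ : ℝ := κ - 1 with hθdef
  have hθ : 0 < θ := by rw [hθdef]; linarith
  have hCS : 0 ≤ (3 + β + 2 * b₁ + B + (σ - γ)) * 2 ^ (1 + β) * 3 ^ (σ - γ) *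
      (κ ^ (β + 1) / θ) * ((2 + b₁) * 2) * (2 + a) ^ 2 := by
    have : 0 ≤ 3 + β + 2 * b₁ + B + (σ - γ) := by linarith
    positivity
  have hcK : 0 < ((lam / (8 * (1 + b₁))) ^ (1 / β) / 2) ^ σ / 2 * a := by positivity
  -- a large level N₀
  obtain ⟨N₀, hN3, h1, h2, h3, h4⟩ := ((eventually_ge_atTop (max 3 n₆)).and
    ((soloX_hbig_eventually (B := B) hlam hb₁ hBnn hβ1 hν2).and
    ((soloX_E0_eventually hc₁ he₀ (max n₀ 1) (2 / (1 - r)) (soloX_habs_tail hA₂ hβ)).and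
    ((soloX_demand_coeff (A₆ := A₆) (a := a) hc₁ he₀ hσ hδ.le hA₆ hq).and
    (soloX_endgame hCS hcK hq))))).exists
  have hN₀3 : 3 ≤ N₀ := le_trans (le_max_left _ _) hN3
  have hN₀6 : n₆ ≤ N₀ := le_trans (le_max_right _ _) hN3
  have hN₀1 : 1 ≤ N₀ := by omega
  have hN₀r : (3 : ℝ) ≤ N₀ := by exact_mod_cast hN₀3
  -- the entry bound E₀
  have hEβ := soloX_E0_rpow_le (ν := ν) hcE.le hβ0 N₀
  obtain ⟨E₀, hE₀def⟩ :
      ∃ E₀ : ℕ, ⌊(lam / (8 * (1 + b₁))) ^ (1 / β) * (N₀ : ℝ) ^ ((ν - 1) / β)⌋₊ = E₀ :=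
    ⟨_, rfl⟩
  rw [hE₀def] at h2 h3 hEβ
  obtain ⟨hE₀m, hE₀r, habs⟩ := h2
  have hE₀n₀ : n₀ ≤ E₀ := le_trans (le_max_left _ _) hE₀m
  have hE₀1 : 1 ≤ E₀ := le_trans (le_max_right _ _) hE₀m
  have hE₀lt : E₀ < N₀ := by
    have i1 : (E₀ : ℝ) ≤ (lam / (8 * (1 + b₁))) ^ (1 / β) * (N₀ : ℝ) ^ ((ν - 1) / β) := by
      rw [← hE₀def]; exact Nat.floor_le (by positivity)
    have i2 : (N₀ : ℝ) ^ ((ν - 1) / β) < N₀ := by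
      calc (N₀ : ℝ) ^ ((ν - 1) / β) < (N₀ : ℝ) ^ (1 : ℝ) :=
            Real.rpow_lt_rpow_of_exponent_lt (by linarith) he₀1
        _ = N₀ := Real.rpow_one _
    have i3 : (lam / (8 * (1 + b₁))) ^ (1 / β) * (N₀ : ℝ) ^ ((ν - 1) / β) ≤
        (N₀ : ℝ) ^ ((ν - 1) / β) := by
      have := mul_le_mul_of_nonneg_right hc₁1 (Real.rpow_nonneg (Nat.cast_nonneg N₀)
        ((ν - 1) / β))
      linarith
    have i4 : (E₀ : ℝ) < N₀ := by linarith
    exact_mod_cast i4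
  -- the window [N₀, N₁]
  obtain ⟨N₁, hN₁def⟩ : ∃ N₁ : ℕ, ⌊(N₀ : ℝ) ^ (1 + a)⌋₊ = N₁ := ⟨_, rfl⟩
  rw [hN₁def] at h3
  have hN₁le : (N₁ : ℝ) ≤ (N₀ : ℝ) ^ (1 + a) := by
    rw [← hN₁def]; exact Nat.floor_le (by positivity)
  have hN₁lt : (N₀ : ℝ) ^ (1 + a) < (N₁ : ℝ) + 1 := by
    rw [← hN₁def]; exact Nat.lt_floor_add_one _
  have hN₀N₁ : N₀ ≤ N₁ := by
    rw [← hN₁def]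
    exact Nat.le_floor (Real.self_le_rpow_of_one_le (by linarith) (by linarith))
  have hEN : E₀ + 1 ≤ N₁ := by omega
  -- the columns K = ⌊E₀^σ⌋₊
  obtain ⟨K, hKdef⟩ : ∃ K : ℕ, ⌊(E₀ : ℝ) ^ σ⌋₊ = K := ⟨_, rfl⟩
  rw [hKdef] at h3
  have hKE : (K : ℝ) ≤ (E₀ : ℝ) ^ σ := by rw [← hKdef]; exact Nat.floor_le (by positivity)
  have hKA : A₆ * (N₁ : ℝ) ^ (σ - γ) ≤ K := by
    have : 0 ≤ ((lam / (8 * (1 + b₁))) ^ (1 / β) / 2) ^ σ / 2 *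
        (N₀ : ℝ) ^ ((ν - 1) / β * σ) := by positivity
    linarith
  -- level facts on the window
  have hW0 : ∀ n ∈ Finset.Icc N₀ N₁, n₀ ≤ n := fun n hn => by
    have := (Finset.mem_Icc.mp hn).1; omega
  have hW6 : ∀ n ∈ Finset.Icc N₀ N₁, n₆ ≤ n := fun n hn =>
    hN₀6.trans (Finset.mem_Icc.mp hn).1
  have hWN : ∀ n ∈ Finset.Icc N₀ N₁, n ≤ N₁ := fun n hn => (Finset.mem_Icc.mp hn).2
  have hM1 : (1 : ℝ) ≤ (N₁ : ℝ) + 2 := by linarith [(Nat.cast_nonneg N₁ : (0 : ℝ) ≤ N₁)]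
  have hWM : ∀ n ∈ Finset.Icc N₀ N₁, (n : ℝ) + 2 ≤ (N₁ : ℝ) + 2 := fun n hn => by
    have := (Finset.mem_Icc.mp hn).2
    have : (n : ℝ) ≤ N₁ := by exact_mod_cast this
    linarith
  have hWK : ∀ n ∈ Finset.Icc N₀ N₁, (K : ℝ) ≤ (n : ℝ) ^ σ := fun n hn => by
    have hn : E₀ ≤ n := by have := (Finset.mem_Icc.mp hn).1; omega
    exact hKE.trans (Real.rpow_le_rpow (Nat.cast_nonneg _) (by exact_mod_cast hn) hσ.le)
  have hbigW : ∀ n ∈ Finset.Icc N₀ N₁, 2 * n * ((E₀ : ℝ) ^ β + b₁ * E₀) +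
      B * (n : ℝ) ^ 2 * Real.log ((n : ℝ) + 2) < lam * (n : ℝ) ^ ν := fun n hn =>
    h1 E₀ hE₀1 hEβ n (Finset.mem_Icc.mp hn).1
  -- the good columns and their servers
  obtain ⟨G, srv, hGs⟩ := D.cheapAssignable_choose h6 (Finset.Icc N₀ N₁) K hW6 hWK
  have hGK : ∀ n ∈ Finset.Icc N₀ N₁, G n ⊆ Finset.Icc 1 K := fun n hn => (hGs n hn).1
  have hgood : ∀ n ∈ Finset.Icc N₀ N₁, ∀ k ∈ G n, srv n k ∈ D.alive n ∧
      lam * (n : ℝ) ^ ν ≤ D.mult (srv n k) n * D.bank (srv n k) k ∧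
      D.bank (srv n k) k ≤ D.cap B (srv n k) n ∧
      (D.mult (srv n k) n : ℝ) * D.cost β (srv n k) n ≤
        η * (n : ℝ) ^ ν * ((G n).filter (fun k' => srv n k' = srv n k)).card :=
    fun n hn => (hGs n hn).2.2
  -- the payment window V e = ⌊κ e⌋₊ lies below every witnessing level
  have hVwit : ∀ n ∈ Finset.Icc N₀ N₁, ∀ k ∈ G n,
      ⌊κ * ((D.entry (srv n k) n : ℕ) : ℝ)⌋₊ ≤ n := by
    intro n hn k hk
    obtain ⟨i1, i2, -, -⟩ := D.good_server hW hB hE hb₁ hβ0.le hA₂ hσ hσ1 hBnn h2η hE₀n₀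
      hE₀1 habs hKE (hW0 n hn) (hbigW n hn) (hGK n hn) (hgood n hn) hk
    have hwin := D.good_window_upper hW hB hE hb₁ hβ1 hν1 hA₂ hσ hσ1 hBnn hη.le h2η hr
      hrν.ge hE₀n₀ hE₀1 habs hKE (hW0 n hn) (hbigW n hn) (hGK n hn) (hgood n hn) hk
    have he1 : 1 ≤ D.entry (srv n k) n := by omega
    have he : 2 / (1 - r) ≤ ((D.entry (srv n k) n : ℕ) : ℝ) := by
      have : E₀ ≤ D.entry (srv n k) n := by omega
      have : (E₀ : ℝ) ≤ ((D.entry (srv n k) n : ℕ) : ℝ) := by exact_mod_cast this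
      linarith
    exact soloX_Vwit hr hr1 he1 he hwin
  have hVwin : ∀ e : ℕ, E₀ + 1 ≤ e → e ≤ ⌊κ * (e : ℝ)⌋₊ ∧
      θ * (e : ℝ) ≤ (⌊κ * (e : ℝ)⌋₊ : ℝ) + 1 - e ∧ (⌊κ * (e : ℝ)⌋₊ : ℝ) ≤ κ * e :=
    fun e _ => soloX_Vwin hκ.le e
  -- supply
  have hsup := D.supply_le hW hB hE hb₁ hβ1 hA₂ hσ hσ1 hBnn hη.le h2η hδ.le hν hθ hκ.le
    hE₀n₀ hE₀1 hEN habs hKE hW0 hWN hM1 hWM hbigW hGK hgood (V := fun e => ⌊κ * (e : ℝ)⌋₊)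
    hVwit hVwin
  have hup := soloX_supply_upper hβ0.le hb₁ hBnn hδ.le hθ hκ.le ha.le hN₀3 hN₀N₁ hN₁le hEN
    (β := β) (κ := κ) (B := B) (b₁ := b₁)
  -- demand
  have hdem := soloX_demand_lower_rate G hA₆ hδ.le hN₀1 (hN₀N₁.trans (Nat.le_succ _))
    hN₁lt.le hKA (fun n hn => (hGs n hn).2.1)
  -- endgame
  have hlog : 0 ≤ Real.log N₀ := Real.log_nonneg (by linarith)
  have h5 : ((lam / (8 * (1 + b₁))) ^ (1 / β) / 2) ^ σ / 2 * (N₀ : ℝ) ^ ((ν - 1) / β * σ) *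
      (a * Real.log N₀) ≤ ((K : ℝ) - A₆ * (N₁ : ℝ) ^ (σ - γ)) * (a * Real.log N₀) :=
    mul_le_mul_of_nonneg_right h3 (by positivity)
  have h6' : ((lam / (8 * (1 + b₁))) ^ (1 / β) / 2) ^ σ / 2 * a *
      (N₀ : ℝ) ^ ((ν - 1) / β * σ) * Real.log N₀ =
      ((lam / (8 * (1 + b₁))) ^ (1 / β) / 2) ^ σ / 2 * (N₀ : ℝ) ^ ((ν - 1) / β * σ) *
      (a * Real.log N₀) := by ring
  linarith [hsup.trans hup]

end Count

end SoloServiceData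

end Summit.Schanuel.Schanuel.Theorems
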